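/-
Origin: expansion seat `planner-pub-hodgecm-mc-sanity-1-g3-0`, handover #2r 2026-08-19T00:38Z md5 939dd94f779a0fc865af8c6c426c5463 SUPERSEDES #2 399f7c8bb9e3 (same src path, same target; RE-CUT against period-2-g4's ThetaSideInstance v2 cb2e6dd72a1f04443b829a3ed64ab2ba (LEVEL-INDEXED Kc/κ/τ/η₁/hη) per ref3-g5 #142 + model1-g4 (J-lvl″) 00:33:39Z; NEW, 205 l., 14 decls in namespace HodgeCM.Model.Sanity; imports HodgeCM.Model.ThetaSideInstance (cb2e6dd72a1f) + HodgeCM.Mo (`HOME/mc/pub-hodgecm-mc-sanity-1-g3/lean/ThetaSideSanity.lean`, md5 939dd94f, 205 lines);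
landed by the gen-9 packager (p-g9) in gate run 33 as `HodgeCM/Model/Sanity/ThetaSideSanity.lean` (verbatim).
-/
/-
Origin: SANITY lane `planner-pub-hodgecm-mc-sanity-1-g3-0` (unit pub-hodgecm-mc-sanity-1-g3, gen 3 of mc-sanity-1,
node SAN-5b), 2026-08-19.  NEW additive leaf under `HodgeCM/Model/Sanity/`; imports mc-period-2-g4's RUN-33 leaf
`HodgeCM.Model.ThetaSideInstance` (v2 LEVEL-INDEXED, md5 cb2e6dd72a1f, kit `mc/pub-hodgecm-mc-period-2/t33-mcperiod2g4.txt`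
#1; the degenerate inputs below take the per-level fields `Kc κ τ η₁ hη` as constant families) and
SAN-5a `HodgeCM.Model.Sanity.ThetaClassesDegenerate`; nothing imports it.  Install AFTER both.  KERNEL: 0 records,
0 hypotheses minted, no global instances.  Expected `#print axioms`: ⊆ {propext, Classical.choice, Quot.sound}.
-/
import Summits.HodgeConjecture.HodgeCM.Model.ThetaSideInstance
import Summits.HodgeConjecture.HodgeCM.Model.Sanity.ThetaClassesDegenerate

/-!
# SAN-5b: the input record of the `Theta` pin is a free data binder — two degenerate inhabitants with opposite verdicts

`Model.thetaOf U I V c i Γ` (mc-period-2-g4, `HodgeCM/Model/ThetaSideInstance`) pins E's data binder `Theta` as a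
FUNCTION of one record `I V c : Model.ThetaClassInput U V c` per context.  This file instantiates the record in the
kernel for EVERY universe `U` and EVERY context `(V, c)` — twice, with all groups trivial (`PUnit`), weight module
`ℂ`, trivial weights, `ΓU = Δ = ⊤`, theta-form spaces `Θ i Γ := ⊥` (NO adelic theta form at all), and the class-map
datum either the ALL-CLASSES datum (`topThetaClassInput`) or the BOTTOM datum (`botThetaClassInput`) of SAN-5a:

* `thetaOf_top : thetaOf U (topThetaClassInput U) V c i Γ = Set.univ` — EVERY degree-one class of `P_Γ` is a
  "theta class" of type `i`, at every level, with no theta form in sight;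
* `thetaOf_bot : thetaOf U (botThetaClassInput U) V c i Γ = {0}`.

Consequences for the E binders that read `Theta` (stated over an arbitrary `U`, so they apply verbatim to
`picardCMUniverse …`):

* «`Θ_i(Γ)` contains a nonzero class» (the exact strength of `classPacks` / `ClassSupplyData`, SAN-4
  `ClassSupplyExact`) is `Nontrivial (U.CohC (U.pms L ι₁ V Γ) 1)` for the top input and `False` for the bottom input
  (`exists_ne_zero_mem_thetaOf_top_iff`, `not_exists_ne_zero_mem_thetaOf_bot`);
* an inclusion binder «`Θ_i(Γ) ⊆ S`» (`hLiu`: `S = U.Uiso Γ M Ψ σ'`) holds for the bottom input as soon as `0 ∈ S`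
  and for the top input only if `S = univ` (`thetaOf_bot_subset_iff`, `thetaOf_top_subset_iff`).

VERDICT (MODEL-N += 0; nothing cited): the pin is definitional bookkeeping — `ThetaClassInput U V c` constrains
nothing by itself (it is inhabited over every `(U, V, c)` with `Θ := ⊥`), so after R6 the theta-side content of
node E sits exactly in the PRODUCER of `I`: (a) its class-map data `(I V c).D Γ` must have injective `pull`
(SAN-5a § 3; else `ker pull` supplies junk theta classes), and then (b) «nonzero class in `Θ_i(Γ)`» = «a form in
`(I V c).Θ i Γ` holomorphic after restriction and non-vanishing on `G_U(ℝ)`» (SAN-5a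
`exists_ne_zero_mem_thetaClasses_iff_of_injective`), i.e. the W6b-1/J3 `thetaForms` of the Weil model.  The
`d12Of`/`d34Of` half of the file is checked to be the all-characters side (`d12Of_allowed_all`): it excludes no
character, so it adds no hypothesis either.
-/

set_option autoImplicit false

noncomputable section

open Function Set

namespace HodgeCM
namespace Model
namespace Sanity

open Literature.NumberTheory.Automorphic Literature.NumberTheory.Automorphic.WeightForms
open HodgeCM.Universe (SideData)

variable (U : Universe)

/-! ## § 1. Two degenerate inputs over every universe and context -/

section Inputs

variable {L : CMField} {ι₁ : L →+* ℂ} (V : HermSpace3 L ι₁) (c : SeesawCtx L)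

/-- **The all-classes input**: all groups `PUnit`, weight module `ℂ` with trivial weights, `ΓU = Δ = ⊤`, class map
= the all-classes datum of SAN-5a at every level, and NO theta forms (`Θ i Γ := ⊥`). -/
def topThetaClassInput : ThetaClassInput U V c where
  GU := PUnit.{1}
  W := ℂ
  G₁ := PUnit.{1}
  K₁ := PUnit.{1}
  ιinf := MonoidHom.id PUnit
  κ₁ := MonoidHom.id PUnit
  τ₁ := 1
  Kc := fun _ => PUnit.{1}
  κ := fun _ => MonoidHom.id PUnit
  τ := fun _ => 1
  η₁ := fun _ => MonoidHom.id PUnit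
  hη := fun _ => punit_isWeightMatched ℂ
  ΓU := fun _ => ⊤
  Δ := fun _ => ⊤
  hΔ := fun _ => punit_isLevelCorrected ℂ ⊤
  D := fun Γ => topClassMapDatum (MonoidHom.id PUnit) (punit_isLevelCorrected ℂ ⊤) (punit_isWeightMatched ℂ)
    (U.CohC (U.pms L ι₁ V Γ) 1)
  Θ := fun _ _ => ⊥

/-- **The bottom input**: the same trivial situation with the bottom class-map datum (`H10 := ⊥`). -/
def botThetaClassInput : ThetaClassInput U V c where
  GU := PUnit.{1}
  W := ℂ
  G₁ := PUnit.{1}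
  K₁ := PUnit.{1}
  ιinf := MonoidHom.id PUnit
  κ₁ := MonoidHom.id PUnit
  τ₁ := 1
  Kc := fun _ => PUnit.{1}
  κ := fun _ => MonoidHom.id PUnit
  τ := fun _ => 1
  η₁ := fun _ => MonoidHom.id PUnit
  hη := fun _ => punit_isWeightMatched ℂ
  ΓU := fun _ => ⊤
  Δ := fun _ => ⊤
  hΔ := fun _ => punit_isLevelCorrected ℂ ⊤
  D := fun Γ => botClassMapDatum (MonoidHom.id PUnit) (punit_isLevelCorrected ℂ ⊤) (punit_isWeightMatched ℂ)
    (U.CohC (U.pms L ι₁ V Γ) 1)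
  Θ := fun _ _ => ⊥

end Inputs

/-! ## § 2. The two verdicts on `thetaOf` -/

section Verdicts

variable {L : CMField} {ι₁ : L →+* ℂ} (V : HermSpace3 L ι₁) (c : SeesawCtx L) (i : Fin 4) (Γ : Level V)

/-- **Through the all-classes input every class is a theta class**, at every type index and level, although the
input carries no theta form (`Θ := ⊥`). -/
theorem thetaOf_top : thetaOf U (fun V c => topThetaClassInput U V c) V c i Γ = univ :=
  thetaClasses_topClassMapDatum _ _

/-- **Through the bottom input only the zero class is a theta class.** -/
theorem thetaOf_bot : thetaOf U (fun V c => botThetaClassInput U V c) V c i Γ = {0} :=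
  thetaClasses_botClassMapDatum _ _

/-- The `classPacks`-strength predicate «`Θ_i(Γ)` has a nonzero class» through the all-classes input is
`Nontrivial H¹(P_Γ, ℂ)`. -/
theorem exists_ne_zero_mem_thetaOf_top_iff :
    (∃ ω ∈ thetaOf U (fun V c => topThetaClassInput U V c) V c i Γ, ω ≠ 0) ↔
      Nontrivial (U.CohC (U.pms L ι₁ V Γ) 1) :=
  exists_ne_zero_mem_thetaClasses_top_iff _ _

/-- … and through the bottom input it is `False`. -/
theorem not_exists_ne_zero_mem_thetaOf_bot :
    ¬ ∃ ω ∈ thetaOf U (fun V c => botThetaClassInput U V c) V c i Γ, ω ≠ 0 := by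
  rw [thetaOf_bot]
  rintro ⟨ω, hω, h0⟩
  exact h0 hω

/-- An inclusion binder `Θ_i(Γ) ⊆ S` (shape of `hLiu`) through the bottom input holds iff `0 ∈ S`. -/
theorem thetaOf_bot_subset_iff (S : Set (U.CohC (U.pms L ι₁ V Γ) 1)) :
    thetaOf U (fun V c => botThetaClassInput U V c) V c i Γ ⊆ S ↔ (0 : U.CohC (U.pms L ι₁ V Γ) 1) ∈ S := by
  rw [thetaOf_bot, singleton_subset_iff]

/-- … and through the all-classes input it holds iff `S` is everything. -/
theorem thetaOf_top_subset_iff (S : Set (U.CohC (U.pms L ι₁ V Γ) 1)) :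
    thetaOf U (fun V c => topThetaClassInput U V c) V c i Γ ⊆ S ↔ S = univ := by
  rw [thetaOf_top, univ_subset_iff]

/-- The two inputs disagree on every nontrivial `H¹`: the pin decides nothing by itself. -/
theorem thetaOf_top_ne_thetaOf_bot [Nontrivial (U.CohC (U.pms L ι₁ V Γ) 1)] :
    thetaOf U (fun V c => topThetaClassInput U V c) V c i Γ ≠
      thetaOf U (fun V c => botThetaClassInput U V c) V c i Γ :=
  thetaClasses_top_ne_bot _ _

end Verdicts

/-! ## § 3. What an HONEST input certifies (injective `pull`): restatement of SAN-5a § 3 at `thetaOf` -/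

section Honest

variable (I : ∀ {L : CMField} {ι₁ : L →+* ℂ} (V : HermSpace3 L ι₁) (c : SeesawCtx L), ThetaClassInput U V c)
variable {L : CMField} {ι₁ : L →+* ℂ} (V : HermSpace3 L ι₁) (c : SeesawCtx L) (i : Fin 4) (Γ : Level V)

/-- With injective class-map pullback at level `Γ`, a nonzero class in `Θ_i(Γ)` is EXACTLY an adelic form of
`(I V c).Θ i Γ`, holomorphic after restriction, non-vanishing somewhere on the archimedean component. -/
theorem exists_ne_zero_mem_thetaOf_iff_of_injective (hinj : Injective ((I V c).D Γ).pull) :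
    (∃ ω ∈ thetaOf U I V c i Γ, ω ≠ 0) ↔
      ∃ F ∈ (I V c).Θ i Γ, restrictHom (I V c).ιinf ((I V c).hΔ Γ) ((I V c).hη Γ) F ∈ ((I V c).D Γ).Hol ∧
        ∃ x : (I V c).G₁, (F : (I V c).GU → (I V c).W) ((I V c).ιinf x) ≠ 0 :=
  exists_ne_zero_mem_thetaClasses_iff_of_injective _ _ hinj _

/-- With injective pullback and NO theta forms (`Θ i Γ = ⊥`) there is no nonzero theta class. -/
theorem thetaOf_eq_singleton_of_injective_of_bot (hinj : Injective ((I V c).D Γ).pull) (h0 : (I V c).Θ i Γ = ⊥) :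
    thetaOf U I V c i Γ = {0} := by
  rw [thetaOf_eq, h0]
  exact thetaClasses_bot_of_injective _ _ hinj

/-- Without injectivity, every class in `ker pull` is in `Θ_i(Γ)` whatever the theta forms are. -/
theorem image_ker_pull_subset_thetaOf :
    ((↑) : ((I V c).D Γ).H10 → U.CohC (U.pms L ι₁ V Γ) 1) '' (LinearMap.ker ((I V c).D Γ).pull : Set _) ⊆
      thetaOf U I V c i Γ :=
  image_ker_pull_subset_thetaClasses _ _ _

end Honest

/-! ## § 4. The side data exclude no character -/

section Side

variable (μ : ∀ {L : CMField}, SeesawCtx L → Fin 4 → NumberField.InfinitePlace L → ℤ)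
variable {L : CMField} (c : SeesawCtx L)

/-- `d12Of` allows every character of its archimedean type (no hypothesis hides in `allowed`). -/
theorem d12Of_allowed_all : ∀ χ, (d12Of μ c).allowed χ := fun χ => d12Of_allowed μ c χ

/-- `d34Of` allows every character of its archimedean type. -/
theorem d34Of_allowed_all : ∀ χ, (d34Of μ c).allowed χ := fun χ => d34Of_allowed μ c χ

end Side

end Sanity
end Model
end HodgeCM

end
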